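import Mathlib
import HarnessLib.Audit
import Summits.PneNP.PneNP.Theorems.PstarGateCompanion

/-!
# One GATED chord, CASE P: every other chord is (EQ) / (EXC) / (NOR) w.r.t. `q = F₂ + t₂`, and at most one is (EQ) (ROUND-25, O2 / E2 (P4); prover-1 g18)

FRONTIER range-avoidance ladder, rung F-N3 (`stmt-PneNP-19007`), cell `pnp-ideate` (this seat's `HOME/pnp-ideate-prover-1/g18/E2-PLAN.md` §3);
restricted-model proof complexity — nothing here bears on `P` versus `NP`.

CASE P of `PstarGateBridge.regime_trichotomy` (the other chords read along the gate's own direction `(1,0)`: the whole model is single-read, `w₂` is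
state-free on the chords).  The clean companion `PstarGateCompanion.companion` (chords `N − e`, first member `R + ℓ`) is then a well-formed,
privates-unread, single-read, constant-read, infeasible chord system, chord-minimal in every chord — so the clean chain's MODEL-level forcing
theorem `PstarChordBridgeForcing.forced_chord_cases_sys` applies to it verbatim.  Translated back (`q` and `freePolar` of the companion are those of
the original second constraint):

* `singleRead_companion`, `q_companion`, `freeMon_companion₂` / `freePolar_companion₂` — bookkeeping;
* `caseP_chord_cases` — **every chord `e' ≠ e` is (EQ) `Q_{D e'} = q + κ`, (EXC) `Q_{D e'} = q + ν₁ν₂ + κ`, or (NOR) (`Z(q)` a codimension-two flat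
  and `Q_{D e'} + γ + 1` in its ideal)**, exactly as in the clean regime theorem, from the RAW one-gate data: (T3), (M0) on the chords, expansion;
* `caseP_EQ_unique` — at most one other chord is (EQ) (`chord_eq_of_EQ`).
With `rank q ≥ 4` every other chord is (EQ) (forcing dichotomy), hence `#(N − e) ≤ 1`: CASE P with two or more other chords lives in rank `q ≤ 2`.
-/

set_option linter.dupNamespace false -- `Summit.PneNP.PneNP.…`: summit = sub-problem name (D-0017 single-conjunct layout)

open Finset Literature.Computability.Complexity
open scoped symmDiff
open Summit.PneNP.PneNP.Theorems.PstarFibrePolys (bit)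
open Summit.PneNP.PneNP.Theorems.PstarTyped (Typed)
open Summit.PneNP.PneNP.Theorems.PstarSALevel (varSet bdry BoundaryExpanding SimpleOverlap)
open Summit.PneNP.PneNP.Theorems.PstarXCore (xverts)
open Summit.PneNP.PneNP.Theorems.PstarCubeIdeals (IsAffineFn)
open Summit.PneNP.PneNP.Theorems.PstarProductRank (qform polar)
open Summit.PneNP.PneNP.Theorems.PstarReadSumset (V2)
open Summit.PneNP.PneNP.Theorems.PstarChordSystem (ChordSystem)
open Summit.PneNP.PneNP.Theorems.PstarChordBridgeTools (privs coef free)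
open Summit.PneNP.PneNP.Theorems.PstarChordBridge (BridgeData sys sys_F sys_t sys_ρ_of_not_mem Solution Lift infeasible_of_not_solution
  chordMinimal_of_solution_erase)
open Summit.PneNP.PneNP.Theorems.PstarChordBridgeForcing (gam freeMon freePolar const_of_unread forced_chord_cases_sys chord_eq_of_EQ)
open Summit.PneNP.PneNP.Theorems.PstarChordBridgeForest (privs_erase)
open Summit.PneNP.PneNP.Theorems.PstarGateBridge (GateHyp gate_reads)
open Summit.PneNP.PneNP.Theorems.PstarGateCompanion

namespace Summit.PneNP.PneNP.Theorems.PstarGateCaseP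

variable {n m : ℕ}

/-- **CASE P: the companion is single-read.** -/
theorem singleRead_companion (I : LocalMap 4 n m) {B : BridgeData n m} (hW : B.WF I) {e : Fin m} (hG : GateHyp I B e) {g₀ : Fin m}
    (hg₀ : g₀ ∈ B.G₁) {u : Fin n} (hgv : (I.vars g₀ 2 = I.vars e 2 ∧ I.vars g₀ 3 = u) ∨ (I.vars g₀ 2 = u ∧ I.vars g₀ 3 = I.vars e 2))
    (hu : u ∉ privs I B.N) (κ₀ : Bool)
    (hP : ∀ e' ∈ B.N, e' ≠ e → ∀ a, ((sys I B).ρ e' a).2 = 0 ∧ ((sys I B).ρ' e' a).2 = 0) :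
    (sys I (companion I B e g₀ u κ₀)).SingleRead := by
  intro i a
  by_cases hi : i ∈ B.N.erase e
  · rw [(sys_companion_ρ I hW hG hg₀ hgv hu κ₀ hi a).1, (sys_companion_ρ I hW hG hg₀ hgv hu κ₀ hi a).2]
    exact hP i (mem_of_mem_erase hi) (ne_of_mem_erase hi) a
  · have h := sys_ρ_of_not_mem I (companion I B e g₀ u κ₀) (by rw [companion_N]; exact hi) a
    rw [h.1, h.2]; exact ⟨rfl, rfl⟩

/-- **The companion's `q = F₂ + t₂` is the original one.** -/
theorem q_companion (I : LocalMap 4 n m) (hI : I.IsPure xorAndPred) {B : BridgeData n m} (hW : B.WF I) {e : Fin m} (hG : GateHyp I B e)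
    (g₀ : Fin m) (u : Fin n) (κ₀ : Bool) (x : Fin n → ZMod 2) :
    ((sys I (companion I B e g₀ u κ₀)).F x).2 + (sys I (companion I B e g₀ u κ₀)).t.2 = ((sys I B).F x).2 + (sys I B).t.2 := by
  rw [sys_F, sys_F, sys_t, sys_t, companion_y, companion_J₀, companion_N, companion_T₂, companion_C₂, companion_G₂, companion_b₂,
    free₂_companion I hI hW hG x]

/-- The private-free monomials of the second constraint are the same for `N − e` and `N`. -/
theorem freeMon_companion₂ (I : LocalMap 4 n m) (hI : I.IsPure xorAndPred) {B : BridgeData n m} (hW : B.WF I) {e : Fin m} (hG : GateHyp I B e) :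
    freeMon I (B.N.erase e) B.G₂ = freeMon I B.N B.G₂ := by
  classical
  have he := hG.1
  have hpp' : I.vars e 3 ≠ I.vars e 2 := fun h => absurd (hI.2 e h) (by decide)
  have hG₂p := hG.2.2.1
  have hG₂p' : ∀ g ∈ B.G₂, I.vars g 2 ≠ I.vars e 3 ∧ I.vars g 3 ≠ I.vars e 3 :=
    (hG.2.1 _ (PstarChordBridgeTools.vars_mem_privs I he (s := 3) (by decide)) hpp').2
  unfold PstarChordBridgeForcing.freeMon
  refine filter_congr fun g hg => ?_
  rw [privs_erase I hW.hN hW.hchord he, privs_erase I hW.hN hW.hchord he]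
  obtain ⟨h2p, h3p⟩ := hG₂p g hg
  obtain ⟨h2p', h3p'⟩ := hG₂p' g hg
  constructor
  · intro h hor
    exact h (hor.imp (fun h2 => ⟨h2, h2p, h2p'⟩) (fun h3 => ⟨h3, h3p, h3p'⟩))
  · intro h hor
    exact h (hor.imp (fun h2 => h2.1) (fun h3 => h3.1))

/-- Hence the second polar form is unchanged. -/
theorem freePolar_companion₂ (I : LocalMap 4 n m) (hI : I.IsPure xorAndPred) {B : BridgeData n m} (hW : B.WF I) {e : Fin m} (hG : GateHyp I B e) :
    freePolar I (B.N.erase e) B.T₂ B.G₂ = freePolar I B.N B.T₂ B.G₂ := by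
  unfold PstarChordBridgeForcing.freePolar
  rw [freeMon_companion₂ I hI hW hG]

/-- **CASE P: every other chord is (EQ) / (EXC) / (NOR) w.r.t. `q = F₂ + t₂`.**  Raw one-gate data: pure typed `(r,3/2)`-expanding instance with
simple overlaps; well-formed liftable one-gate bridge data (`GateHyp`, one gate `g₀ = (p, u)`, `u` no private and no XOR vertex), `#J₀ ≤ r`, (T3),
(M0) on the chords; CASE P: every other chord's reads have second coordinate `0`. -/
theorem caseP_chord_cases (I : LocalMap 4 n m) (hI : I.IsPure xorAndPred) (hT : Typed I) (hS : SimpleOverlap I) {r : ℕ}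
    (hB : BoundaryExpanding r I) {B : BridgeData n m} (hW : B.WF I) (hr : B.J₀.card ≤ r) (hL : Lift I B) {e : Fin m} (hG : GateHyp I B e)
    {g₀ : Fin m} (hg₀ : g₀ ∈ B.G₁) {u : Fin n} (hgv : (I.vars g₀ 2 = I.vars e 2 ∧ I.vars g₀ 3 = u) ∨ (I.vars g₀ 2 = u ∧ I.vars g₀ 3 = I.vars e 2))
    (hu : u ∉ privs I B.N) (hux : u ∉ xverts I (B.J₀ \ B.N)) (hG₁p : ∀ g ∈ B.G₁.erase g₀, I.vars g 2 ≠ I.vars e 2 ∧ I.vars g 3 ≠ I.vars e 2)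
    (hT3 : ¬ ∃ z, Solution I B B.J₀ z) (hM0 : ∀ f ∈ B.N, ∃ z, Solution I B (B.J₀.erase f) z)
    (hP : ∀ e' ∈ B.N, e' ≠ e → ∀ a, ((sys I B).ρ e' a).2 = 0 ∧ ((sys I B).ρ' e' a).2 = 0)
    {e' : Fin m} (he' : e' ∈ B.N) (hne : e' ≠ e) :
    (∃ κ : ZMod 2, ∀ x, qform (B.D e') (fun j => I.vars j 2) (fun j => I.vars j 3) x = (((sys I B).F x).2 + (sys I B).t.2) + κ) ∨
    (∃ ν₁ ν₂ : (Fin n → ZMod 2) → ZMod 2, IsAffineFn ν₁ ∧ IsAffineFn ν₂ ∧ ∃ κ : ZMod 2, ∀ x,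
      qform (B.D e') (fun j => I.vars j 2) (fun j => I.vars j 3) x = (((sys I B).F x).2 + (sys I B).t.2) + ν₁ x * ν₂ x + κ) ∨
    (∃ a b : Fin n → ZMod 2, freePolar I B.N B.T₂ B.G₂ a b = 1 ∧
      (∀ x, ((sys I B).F x).2 + (sys I B).t.2 =
        (freePolar I B.N B.T₂ B.G₂ x b + ((((sys I B).F b).2 + (sys I B).t.2) + (((sys I B).F 0).2 + (sys I B).t.2))) *
          (freePolar I B.N B.T₂ B.G₂ x a + ((((sys I B).F a).2 + (sys I B).t.2) + (((sys I B).F 0).2 + (sys I B).t.2))) + 1) ∧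
      ∃ m₁ m₂ : (Fin n → ZMod 2) → ZMod 2, IsAffineFn m₁ ∧ IsAffineFn m₂ ∧
        ∀ x, qform (B.D e') (fun j => I.vars j 2) (fun j => I.vars j 3) x + (gam B e' + 1) =
          (freePolar I B.N B.T₂ B.G₂ x b + ((((sys I B).F b).2 + (sys I B).t.2) + (((sys I B).F 0).2 + (sys I B).t.2)) + 1) * m₁ x +
          (freePolar I B.N B.T₂ B.G₂ x a + ((((sys I B).F a).2 + (sys I B).t.2) + (((sys I B).F 0).2 + (sys I B).t.2)) + 1) * m₂ x) := by
  classical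
  set κ₀ := decide (I.vars e 2 ∈ B.C₁) with hκ₀
  set B₀ := companion I B e g₀ u κ₀ with hB₀
  have hinf : (sys I B).Infeasible B.N := infeasible_of_not_solution I hI hT hW hL hT3
  have hW₀ : B₀.WF I := companion_wf I hI hT hW hG g₀ hux κ₀
  have hr₀ : B₀.J₀.card ≤ r := hr
  have hSR₀ : (sys I B₀).SingleRead := singleRead_companion I hW hG hg₀ hgv hu κ₀ hP
  have hconst₀ := const_of_unread I B₀ (companion_hun I hW hG g₀ u κ₀)
  have hinf₀ : (sys I B₀).Infeasible B₀.N := infeasible_companion I hI hW hG hg₀ hgv hu hux hG₁p hinf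
  have he'₀ : e' ∈ B₀.N := by rw [hB₀, companion_N]; exact mem_erase.2 ⟨hne, he'⟩
  -- chord-minimality of `e'` for the companion (CASE P)
  have hSa : ∀ a, ∀ k ∈ B.N, ((sys I B).ρ k a).2 = 0 ∧ ((sys I B).ρ' k a).2 = 0 := by
    intro a k hk
    by_cases hke : k = e
    · subst hke
      obtain ⟨hρ, hρ'⟩ := gate_reads I hI hG a
      rw [hρ, hρ']; exact ⟨rfl, rfl⟩
    · exact hP k hk hke a
  have hM₀ : (sys I B₀).ChordMinimal B₀.N e' := by
    obtain ⟨z, hz⟩ := hM0 e' he'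
    obtain ⟨a, s, hadm, hval⟩ := chordMinimal_of_solution_erase I hI hT hW he' hz
    exact chordMinimal_companion_of_singleRead I hI hW hG hg₀ hgv hu hux hG₁p hinf (mem_erase.2 ⟨hne, he'⟩) hadm hval (hSa a)
  have h := forced_chord_cases_sys I hI hS hB hW₀ hr₀ hSR₀ hconst₀ hinf₀ he'₀ hM₀
  -- translate back to `B`
  have hq : ∀ x, ((sys I B₀).F x).2 + (sys I B₀).t.2 = ((sys I B).F x).2 + (sys I B).t.2 := fun x => q_companion I hI hW hG g₀ u κ₀ x
  have hfp : freePolar I B₀.N B₀.T₂ B₀.G₂ = freePolar I B.N B.T₂ B.G₂ := by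
    rw [hB₀, companion_N, companion_T₂, companion_G₂]; exact freePolar_companion₂ I hI hW hG
  have hD : B₀.D = B.D := rfl
  have hgam : gam B₀ e' = gam B e' := rfl
  simp only [hq, hfp, hD, hgam] at h
  exact h

/-- **CASE P: at most one other chord is (EQ).** -/
theorem caseP_EQ_unique (I : LocalMap 4 n m) (hI : I.IsPure xorAndPred) (hS : SimpleOverlap I) {B : BridgeData n m} (hW : B.WF I) {e' e'' : Fin m}
    (he' : e' ∈ B.N) (he'' : e'' ∈ B.N) {κ κ' : ZMod 2}
    (h' : ∀ x, qform (B.D e') (fun j => I.vars j 2) (fun j => I.vars j 3) x = (((sys I B).F x).2 + (sys I B).t.2) + κ)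
    (h'' : ∀ x, qform (B.D e'') (fun j => I.vars j 2) (fun j => I.vars j 3) x = (((sys I B).F x).2 + (sys I B).t.2) + κ') : e' = e'' :=
  chord_eq_of_EQ I hI hS hW he' he'' h' h''

end Summit.PneNP.PneNP.Theorems.PstarGateCaseP
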